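import Summits.QuantumFields.BalabanUV.T4Continuum.Support.NE7K1LinBoxThm110DerivStep
import Literature.MathematicalPhysics.QuantumFieldTheory.Balaban1983to89.B4Thm19ZeroBoxHolder

/-!
# NE7K1LinBoxHolderRow — row NE7 (node U5), candidate route HOM, path H1L, cell K1-lin(s): card §3y STEP 7, PART 9 —
# B4 LEMMA 2.4 (2.36) FOR THE TWO-CUTOFF LINE IN THE TWO-CENTRE FORM AND ITS TRANSPORT TO EVERY SCALE OF THE FINE BOX
# (the Hölder input of (1.9) for the line)

Lineage `b2b-balaban-t4-ne7-p2` (CRUX PROVER NE7 #2), generation 79; file 102.  b04's `B4Thm19ZeroBoxHolder` §2–§3 for the line.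

* §1 **`boxLine_blockRowHolder_bound`** — (2.36) FOR THE LINE ON A NEUMANN BOX, unrestricted two-centre form: for `0 ≤ α < 1`,
  `(n∕|x′−x|_∞)^α·|n·Σ_{x″ ∈ B(y)}[(G^Π(s)(x′+e_μ,x″) − G^Π(s)(x′,x″)) − (G^Π(s)(x+e_μ,x″) − G^Π(s)(x,x″))]| ≤ C·e^{−κ·min(|blk x − y|, |blk x′ − y|)}`
  for EVERY mesh `n`, `s ∈ [0,1]`, `a ∈ [a₋,a₊]`, box, axis and pair `x ≠ x′` — assembled from file 82's printed-shape statements: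
  `lemma24_line_236` (the pair at distance `≤ 1`, i.e. `|x′−x|_∞ ≤ n` fine steps, file 79's `boxResolventKernel_holder_decay`) and,
  for distant pairs (`|x′−x|_∞ > n`, where the Hölder weight is `≤ 1`), twice `lemma24_line_235_second`; constants in
  `(d, α, a₋, a₊)` ONLY.
* §2 **`GfineL_blockRowHolder_bound`** — transport to the fine box with the factor `s_j^α·s_j^{−1} = (L^jη)^{1−α}` of [B4] (2.38).

HONEST FRAMING: [folklore]; A = 0; nothing of Bałaban's asserted; no `sorry`.  Census only (STEP 7, Hölder clause, inputs); NE7 NOT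
PRINTED ∕ NOT PROVED; spine 0∕9; FIXED FINITE T⁴, rung (B)+1; NOT infinite volume, NOT mass gap, NOT Clay.  HONEST DEPENDENCY: continuum
YM on T⁴ ⇐ BetaPertH ∧ nine spine estimates (0/9 proved); BetaPertH ⇐ (D1) ∧ (D4) ∧ CAP+tail; G-an2-4 gates asym, D1 and NE2/3/4.
-/

noncomputable section

open Finset Matrix

namespace Summit.QuantumFields.BalabanUV.T4Continuum.NE7K1LinBoxHolderRow

open Literature.MathematicalPhysics.QuantumFieldTheory.Balaban1983to89
open Literature.MathematicalPhysics.QuantumFieldTheory.Balaban1983to89.B4Reflection242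
open Literature.MathematicalPhysics.QuantumFieldTheory.Balaban1983to89.B4Lower18
open Literature.MathematicalPhysics.QuantumFieldTheory.Balaban1983to89.B4ContourShift (supNorm supNorm_nonneg abs_le_supNorm)
open Literature.MathematicalPhysics.QuantumFieldTheory.Balaban1983to89.B4BoxCov237
open Literature.MathematicalPhysics.QuantumFieldTheory.Balaban1983to89.B4Thm110ZeroBox
open Literature.MathematicalPhysics.QuantumFieldTheory.Balaban1983to89.B4Thm110ZeroBoxDeriv
open Literature.MathematicalPhysics.QuantumFieldTheory.Balaban1983to89.B4Thm19ZeroBoxHolder (Lk_eq_sc_mul_bj)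
open Literature.MathematicalPhysics.QuantumFieldTheory.Balaban1983to89.B4StripSumsHolder (one_le_supNorm)
open NE7K1LinSchurLineU1 NE7K1LinSchurFoldBox NE7K1LinBoxCovEnergy NE7K1LinLineLaplacian NE7K1LinBoxScales
open NE7K1LinBoxLemma24

variable {d : ℕ}

/-! ### §1 (2.36) for the line on a Neumann box, two-centre form -/

/-- the doubly differenced single `if`-sum is the second difference of the four filtered block-row sums. [folklore] -/
theorem dd_sum_eq {n : ℕ} {N : Fin (d + 1) → ℕ} (G : Matrix ↥(boxDom N) ↥(boxDom N) ℝ) (x xe x' xe' : ↥(boxDom N))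
    (y : Fin (d + 1) → ℤ) :
    ∑ x'' : ↥(boxDom N), (if blk n x''.1 = y then (G xe' x'' - G x' x'') - (G xe x'' - G x x'') else 0)
      = (∑ x'' ∈ Finset.univ.filter (fun x'' : ↥(boxDom N) => blk n x''.1 = y), G xe' x''
          - ∑ x'' ∈ Finset.univ.filter (fun x'' : ↥(boxDom N) => blk n x''.1 = y), G x' x'')
        - (∑ x'' ∈ Finset.univ.filter (fun x'' : ↥(boxDom N) => blk n x''.1 = y), G xe x''
          - ∑ x'' ∈ Finset.univ.filter (fun x'' : ↥(boxDom N) => blk n x''.1 = y), G x x'') := by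
  rw [← Finset.sum_sub_distrib, ← Finset.sum_sub_distrib, ← Finset.sum_sub_distrib, Finset.sum_filter]

/-- **(2.36) FOR THE TWO-CUTOFF LINE ON A NEUMANN BOX, TWO-CENTRE FORM**: for `0 ≤ α < 1` there are `κ > 0`, `C ≥ 0` in
`(d, α, a₋, a₊)` with `(n∕|x′−x|_∞)^α·|n·Σ_{x″ ∈ B(y)}[(G^Π(s)(xe′,x″) − G^Π(s)(x′,x″)) − (G^Π(s)(xe,x″) − G^Π(s)(x,x″))]|
≤ C·e^{−κ·min(|blk_n x − y|_∞, |blk_n x′ − y|_∞)}` for every mesh `n ≥ 1`, `a ∈ [a₋,a₊]`, `s ∈ [0,1]`, box `M`, axis `μ`, neighbours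
`xe = x + e_μ`, `xe′ = x′ + e_μ`, `x′ ≠ x` and `y ∈ □^{(j)}` (`G^Π(s) = boxLine⁻¹`). [cite: Balaban1983RegularityDecay, p. 582 Lemma 2.4
(2.36), for the two-cutoff line] -/
theorem boxLine_blockRowHolder_bound (d ℓ : ℕ) (aminus aplus : ℝ) (ha : 0 < aminus) {α : ℝ} (hα0 : 0 ≤ α) (hα1 : α < 1) :
    ∃ κ C : ℝ, 0 < κ ∧ 0 ≤ C ∧ ∀ (n : ℕ) (hn : 1 ≤ n) (a s : ℝ), aminus ≤ a → a ≤ aplus → 0 ≤ s → s ≤ 1 →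
      ∀ (M : Fin (d + 1) → ℕ), (∀ i, 1 ≤ M i) →
        ∀ (μ : Fin (d + 1)) (x xe x' xe' : ↥(boxDom (fun i => n * M i))), xe.1 = x.1 + Pi.single μ 1 →
          xe'.1 = x'.1 + Pi.single μ 1 → x'.1 ≠ x.1 →
        ∀ (y : Fin (d + 1) → ℤ), y ∈ boxDom M →
          ((n : ℝ) / supNorm (x'.1 - x.1)) ^ α *
              |(n : ℝ) * ∑ x'' : ↥(boxDom (fun i => n * M i)),
                (if blk n x''.1 = y then
                  ((boxLine (ℓ + 1) hn M a s)⁻¹ xe' x'' - (boxLine (ℓ + 1) hn M a s)⁻¹ x' x'')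
                    - ((boxLine (ℓ + 1) hn M a s)⁻¹ xe x'' - (boxLine (ℓ + 1) hn M a s)⁻¹ x x'') else 0)|
            ≤ C * Real.exp (-(κ * min (supNorm (blk n x.1 - y)) (supNorm (blk n x'.1 - y)))) := by
  obtain ⟨δ₁, c₁, hδ₁, hc₁, hH⟩ := lemma24_line_236 d aminus aplus ha hα0 hα1
  obtain ⟨δ₂, c₂, hδ₂, hc₂, hD⟩ := lemma24_line_235_second d aminus aplus ha
  refine ⟨min δ₁ δ₂, c₁ + 2 * c₂, lt_min hδ₁ hδ₂, by positivity, ?_⟩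
  intro n hn a s h1 h2 hs0 hs1 M hM μ x xe x' xe' hxe hxe' hne y hy
  set G := (boxLine (ℓ + 1) hn M a s)⁻¹ with hG
  set m : ℝ := min (supNorm (blk n x.1 - y)) (supNorm (blk n x'.1 - y)) with hm
  have hm0 : 0 ≤ m := le_min (supNorm_nonneg _) (supNorm_nonneg _)
  have hmx : m ≤ supNorm (blk n x.1 - y) := min_le_left _ _
  have hmx' : m ≤ supNorm (blk n x'.1 - y) := min_le_right _ _
  have hn0 : (0 : ℝ) < n := by exact_mod_cast hn
  -- exponential comparisons
  have hexp : ∀ {δ t : ℝ}, min δ₁ δ₂ ≤ δ → m ≤ t → Real.exp (-(δ * t)) ≤ Real.exp (-(min δ₁ δ₂ * m)) := by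
    intro δ t hδ ht
    apply Real.exp_le_exp.2
    have h0 : 0 ≤ min δ₁ δ₂ := (lt_min hδ₁ hδ₂).le
    nlinarith [mul_le_mul hδ ht hm0 (h0.trans hδ)]
  rw [dd_sum_eq]
  set sv : Fin (d + 1) → ℤ := x'.1 - x.1 with hsv
  have hsv0 : sv ≠ 0 := sub_ne_zero.2 hne
  by_cases hnear : ∀ ν, |sv ν| ≤ n
  · -- the pair at distance ≤ 1: file 82's (2.36)
    have hx₂ : x'.1 = x.1 + sv := by rw [hsv]; abel
    have hx₃ : xe'.1 = x.1 + sv + B4Green244.e μ := by rw [hxe', hx₂]; rfl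
    have hb := hH n hn (ℓ + 1) inferInstance a s h1 h2 hs0 hs1 M hM μ sv hsv0 hnear x xe x' xe' hxe hx₂ hx₃ ⟨y, hy⟩
    refine hb.trans ?_
    calc c₁ * Real.exp (-(δ₁ * supNorm (blk n x.1 - y)))
        ≤ c₁ * Real.exp (-(min δ₁ δ₂ * m)) := mul_le_mul_of_nonneg_left (hexp (min_le_left _ _) hmx) hc₁.le
      _ ≤ (c₁ + 2 * c₂) * Real.exp (-(min δ₁ δ₂ * m)) :=
          mul_le_mul_of_nonneg_right (by linarith) (Real.exp_pos _).le
  · -- distant pair: the Hölder weight is ≤ 1, and the two differences decay separately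
    push Not at hnear
    obtain ⟨ν, hν⟩ := hnear
    have hsn : (n : ℝ) ≤ supNorm sv := by
      have h1' : |((sv ν : ℤ) : ℝ)| ≤ supNorm sv := by
        have := abs_le_supNorm sv ν
        rwa [Int.cast_abs] at this
      have h2' : ((n : ℤ) : ℝ) < ((|sv ν| : ℤ) : ℝ) := by exact_mod_cast hν
      rw [Int.cast_abs, Int.cast_natCast] at h2'
      linarith
    have hσ0 : 0 < supNorm sv := lt_of_lt_of_le hn0 hsn
    have hW1 : ((n : ℝ) / supNorm sv) ^ α ≤ 1 :=
      Real.rpow_le_one (div_nonneg hn0.le hσ0.le) ((div_le_one hσ0).2 hsn) hα0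
    have hW0 : 0 ≤ ((n : ℝ) / supNorm sv) ^ α := Real.rpow_nonneg (div_nonneg hn0.le hσ0.le) α
    have hb1 := hD n hn (ℓ + 1) inferInstance a s h1 h2 hs0 hs1 M hM μ x xe hxe ⟨y, hy⟩
    have hb2 := hD n hn (ℓ + 1) inferInstance a s h1 h2 hs0 hs1 M hM μ x' xe' hxe' ⟨y, hy⟩
    have habs : |(n : ℝ) * ((∑ x'' ∈ Finset.univ.filter (fun x'' : ↥(boxDom fun i => n * M i) => blk n x''.1 = y), G xe' x''
            - ∑ x'' ∈ Finset.univ.filter (fun x'' : ↥(boxDom fun i => n * M i) => blk n x''.1 = y), G x' x'')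
          - (∑ x'' ∈ Finset.univ.filter (fun x'' : ↥(boxDom fun i => n * M i) => blk n x''.1 = y), G xe x''
            - ∑ x'' ∈ Finset.univ.filter (fun x'' : ↥(boxDom fun i => n * M i) => blk n x''.1 = y), G x x''))|
        ≤ c₂ * Real.exp (-(δ₂ * supNorm (blk n x'.1 - y))) + c₂ * Real.exp (-(δ₂ * supNorm (blk n x.1 - y))) := by
      rw [mul_sub]
      exact (abs_sub _ _).trans (add_le_add hb2 hb1)
    calc ((n : ℝ) / supNorm sv) ^ α * |(n : ℝ) * _|
        ≤ 1 * (c₂ * Real.exp (-(δ₂ * supNorm (blk n x'.1 - y))) + c₂ * Real.exp (-(δ₂ * supNorm (blk n x.1 - y)))) :=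
          mul_le_mul hW1 habs (abs_nonneg _) zero_le_one
      _ ≤ 1 * (c₂ * Real.exp (-(min δ₁ δ₂ * m)) + c₂ * Real.exp (-(min δ₁ δ₂ * m))) := by
          refine mul_le_mul_of_nonneg_left (add_le_add ?_ ?_) zero_le_one
          · exact mul_le_mul_of_nonneg_left (hexp (min_le_right _ _) hmx') hc₂.le
          · exact mul_le_mul_of_nonneg_left (hexp (min_le_right _ _) hmx) hc₂.le
      _ ≤ (c₁ + 2 * c₂) * Real.exp (-(min δ₁ δ₂ * m)) := by
          have := Real.exp_pos (-(min δ₁ δ₂ * m))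
          nlinarith

/-! ### §2 Transport to the fine box: the factor `s_j^α·s_j^{-1} = (L^jη)^{1−α}` -/

/-- **DOUBLY DIFFERENCED, HÖLDER-WEIGHTED BLOCK-ROW SUMS OF `𝒢_j(s)` DECAY ABOUT THE PAIR** — transport of (2.36) for the line to
the fine box (`𝒢_j(s) = s_j^{-2}G^Π(s; L^j, a_j)`, `L^k = s_jb_j`): for lattice neighbours `xe = x + e_μ`, `xe′ = x′ + e_μ`, `x′ ≠ x`,
`(L^k/|x′−x|_∞)^α·|L^k·Σ_{x″ : blk_{b_j}x″ = y}[(𝒢_j(xe′,x″) − 𝒢_j(x′,x″)) − (𝒢_j(xe,x″) − 𝒢_j(x,x″))]|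
≤ s_j^α·s_j^{-1}·C·e^{−κ·min(|blk_{b_j}x − y|, |blk_{b_j}x′ − y|)}` — the factor `(L^jη)^{1−α}` of [B4] (2.38); b04's
`Gfine_blockRowHolder_bound` re-run over §1. [cite: Balaban1983RegularityDecay, p. 582 Lemma 2.4 (2.36), (2.38), for the two-cutoff line] -/
theorem GfineL_blockRowHolder_bound (d ℓ : ℕ) (hℓ : 1 ≤ ℓ) (aminus aplus : ℝ) (ha : 0 < aminus)
    {α : ℝ} (hα0 : 0 ≤ α) (hα1 : α < 1) :
    ∃ κ C : ℝ, 0 < κ ∧ 0 ≤ C ∧ ∀ (k j : ℕ), 1 ≤ j → ∀ (hj : j + 1 ≤ k), ∀ (a s : ℝ), aminus ≤ a → a ≤ aplus →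
      0 ≤ s → s ≤ 1 → ∀ (M : Fin (d + 1) → ℕ), (∀ i, 1 ≤ M i) →
        ∀ (μ : Fin (d + 1)) (x xe x' xe' : ↥(boxDom (Nf ℓ k M))), xe.1 = x.1 + Pi.single μ 1 →
          xe'.1 = x'.1 + Pi.single μ 1 → x'.1 ≠ x.1 →
        ∀ (y : Fin (d + 1) → ℤ), y ∈ boxDom (Mj ℓ k M j) →
          ((((ℓ + 1) ^ k : ℕ) : ℝ) / supNorm (x'.1 - x.1)) ^ α *
            |(((ℓ + 1) ^ k : ℕ) : ℝ) * ∑ x'' : ↥(boxDom (Nf ℓ k M)),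
              (if blk (bj ℓ j) x''.1 = y then
                (GfineL ℓ k M j a s xe' x'' - GfineL ℓ k M j a s x' x'')
                  - (GfineL ℓ k M j a s xe x'' - GfineL ℓ k M j a s x x'') else 0)|
            ≤ sc ℓ k j ^ α * (sc ℓ k j)⁻¹ * C *
                Real.exp (-(κ * min (supNorm (blk (bj ℓ j) x.1 - y)) (supNorm (blk (bj ℓ j) x'.1 - y)))) := by
  obtain ⟨κ, C, hκ, hC, h⟩ := boxLine_blockRowHolder_bound d ℓ (aminus * (1 - ((((ℓ : ℝ) + 1)) ^ 2)⁻¹))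
    aplus (aminus'_pos hℓ ha) hα0 hα1
  refine ⟨κ, C, hκ, hC, fun k j hj1 hj a s h1 h2 h3 h4 M hM μ x xe x' xe' hxe hxe' hne y hy => ?_⟩
  have ha0 : 0 < a := lt_of_lt_of_le ha h1
  obtain ⟨hw1, hw2, hapos⟩ := aSeq_window hℓ ha h1 h2 hj1
  have hs : 0 < sc ℓ k j ^ 2 := pow_pos (sc_pos ℓ k j) 2
  have hsc0 : sc ℓ k j ≠ 0 := (sc_pos ℓ k j).ne'
  have hxe1 : ((ej ℓ k M j hj).symm xe).1 = ((ej ℓ k M j hj).symm x).1 + Pi.single μ 1 := hxe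
  have hxe1' : ((ej ℓ k M j hj).symm xe').1 = ((ej ℓ k M j hj).symm x').1 + Pi.single μ 1 := hxe'
  have hne1 : ((ej ℓ k M j hj).symm x').1 ≠ ((ej ℓ k M j hj).symm x).1 := hne
  have hrow := h (bj ℓ j) (bj_pos ℓ j) _ s hw1 hw2 h3 h4 (Mj ℓ k M j) (Mj_pos hM) μ
    ((ej ℓ k M j hj).symm x) ((ej ℓ k M j hj).symm xe) ((ej ℓ k M j hj).symm x') ((ej ℓ k M j hj).symm xe')
    hxe1 hxe1' hne1 y hy
  have hxv : ((ej ℓ k M j hj).symm x).1 = x.1 := rfl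
  have hxv' : ((ej ℓ k M j hj).symm x').1 = x'.1 := rfl
  rw [hxv, hxv'] at hrow
  -- the weight `(n/|σ|)^α·|n·S|` of the scale-`j` box, `n = b_j`
  set W : ℝ := (((bj ℓ j : ℕ) : ℝ) / supNorm (x'.1 - x.1)) ^ α with hW
  have hσ1 : 1 ≤ supNorm (x'.1 - x.1) := one_le_supNorm (sub_ne_zero.2 hne)
  have hσ0 : 0 < supNorm (x'.1 - x.1) := lt_of_lt_of_le one_pos hσ1
  have hW0 : 0 ≤ W := Real.rpow_nonneg (div_nonneg (Nat.cast_nonneg _) hσ0.le) α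
  have hsum : ∑ x'' : ↥(boxDom (Nf ℓ k M)),
      (if blk (bj ℓ j) x''.1 = y then
        (GfineL ℓ k M j a s xe' x'' - GfineL ℓ k M j a s x' x'')
          - (GfineL ℓ k M j a s xe x'' - GfineL ℓ k M j a s x x'') else 0)
      = (sc ℓ k j ^ 2)⁻¹ * ∑ z : ↥(boxDom (fun i => bj ℓ j * Mj ℓ k M j i)),
          (if blk (bj ℓ j) z.1 = y then
            ((boxLine (ℓ + 1) (bj_pos ℓ j) (Mj ℓ k M j) (B1.aSeq a ((ℓ : ℝ) + 1) j) s)⁻¹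
                ((ej ℓ k M j hj).symm xe') z
              - (boxLine (ℓ + 1) (bj_pos ℓ j) (Mj ℓ k M j) (B1.aSeq a ((ℓ : ℝ) + 1) j) s)⁻¹
                ((ej ℓ k M j hj).symm x') z)
            - ((boxLine (ℓ + 1) (bj_pos ℓ j) (Mj ℓ k M j) (B1.aSeq a ((ℓ : ℝ) + 1) j) s)⁻¹
                ((ej ℓ k M j hj).symm xe) z
              - (boxLine (ℓ + 1) (bj_pos ℓ j) (Mj ℓ k M j) (B1.aSeq a ((ℓ : ℝ) + 1) j) s)⁻¹
                ((ej ℓ k M j hj).symm x) z) else 0) := by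
    rw [sum_Nf_eq_sum_ej hj, Finset.mul_sum]
    refine Finset.sum_congr rfl fun z _ => ?_
    have hzv : (ej ℓ k M j hj z).1 = z.1 := rfl
    rw [hzv]
    split_ifs with hz
    · rw [GfineL_apply hℓ hj1 hj hM ha0 h3 h4, GfineL_apply hℓ hj1 hj hM ha0 h3 h4, GfineL_apply hℓ hj1 hj hM ha0 h3 h4,
        GfineL_apply hℓ hj1 hj hM ha0 h3 h4, Equiv.symm_apply_apply]
      ring
    · rw [mul_zero]
  have hnR : ((((ℓ + 1) ^ k : ℕ)) : ℝ) = sc ℓ k j * ((bj ℓ j : ℕ) : ℝ) := Lk_eq_sc_mul_bj (by omega)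
  have heq : ∀ S : ℝ, (((ℓ + 1) ^ k : ℕ) : ℝ) * ((sc ℓ k j ^ 2)⁻¹ * S)
      = (sc ℓ k j)⁻¹ * (((bj ℓ j : ℕ) : ℝ) * S) := by
    intro S
    rw [hnR]
    field_simp
  -- the Hölder weight of the fine box splits as `s_j^α · W`
  have hwt : ((((ℓ + 1) ^ k : ℕ) : ℝ) / supNorm (x'.1 - x.1)) ^ α = sc ℓ k j ^ α * W := by
    rw [hW, hnR, mul_div_assoc, Real.mul_rpow (sc_pos ℓ k j).le (div_nonneg (Nat.cast_nonneg _) hσ0.le)]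
  rw [hsum, heq, abs_mul, abs_of_pos (inv_pos.2 (sc_pos ℓ k j)), hwt]
  have hsα : 0 ≤ sc ℓ k j ^ α := Real.rpow_nonneg (sc_pos ℓ k j).le α
  calc sc ℓ k j ^ α * W * ((sc ℓ k j)⁻¹ * |((bj ℓ j : ℕ) : ℝ) * _|)
      = sc ℓ k j ^ α * (sc ℓ k j)⁻¹ * (W * |((bj ℓ j : ℕ) : ℝ) * _|) := by ring
    _ ≤ sc ℓ k j ^ α * (sc ℓ k j)⁻¹ *
        (C * Real.exp (-(κ * min (supNorm (blk (bj ℓ j) x.1 - y)) (supNorm (blk (bj ℓ j) x'.1 - y))))) :=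
        mul_le_mul_of_nonneg_left hrow (mul_nonneg hsα (inv_pos.2 (sc_pos ℓ k j)).le)
    _ = _ := by ring


end Summit.QuantumFields.BalabanUV.T4Continuum.NE7K1LinBoxHolderRow

end
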